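import Summits.ABC.StewartYu.PadicG3Supply
import HarnessLib

/-!
# Cell abc-stewartyu, crux `Y07Odd` (stmt-ABC-19658), line `gen3-slab-odd`: FRAME-SIDE SUPPLY for the half-step package — integrality and
# size of the class-sum terms `htermW` (the `hint` / `hsize` of `HalfStepHypU`) in closed form

`Summits/ABC/StewartYu/PadicG3SupplyHalf.lean` — sequel to `PadicG3Supply` (cell `abc-stewartyu`, seat p2-g4, F-odd lead; for the record owners).
Theorems on `G3Setup`; no named fact.  For the level polynomials `Rl H Ŝ lev` (`lev < Ŝ`), an exponent vector `w` in the box `|w_j| ≤ L_j`, an odd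
point `s₁` and an order `τ = (t₀, t)`:
`htermW = Hasse_{t₀}(Rl lev i)(s₁/2) · ∏_k zγ(w)_k^{t_k} · qEhG α (rootExp L w s₁)` is cleared by
`D = ν(H)^{t₀} · |b_{j₀}|^{|t|} · monDen(α, 2L|s₁|)` and has size `≤ 2^{t₀} · M₀′ · Xb^{|t|} · monDen(α, 2L|s₁|)`, where `M₀′` bounds the
level-`(lev+1)` Hasse values at the INTEGER `s₁` (`PadicG3Supply.exists_int_lcm_pow_mul_hasse_Rl`) and `Xb` the directional forms on the box.

* `halfE` (the clearing box `2 L_j |s₁|`), `rootExp_div_two_le`, `exists_int_monDen_mul_qEhG`, `prod_zγ_pow_eq`, **`htermW_clear`**.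

WHAT THIS IS NOT: no budget inequality; no crux moves.

References: Yu. V. Nesterenko, LNM 1819 (2003) §3.1, §4.3; K. Yu, Acta Math. 211 (2013) (5.35)–(5.39).
-/

noncomputable section

open NormedSpace Finset Polynomial
open Literature.NumberTheory.Transcendental
open Literature.NumberTheory.Transcendental.CW77.Setup (Tau tauNorm)
open scoped Nat

namespace Summit.ABC.StewartYu

namespace G3Setup

variable {p : ℕ} [Fact p.Prime] (S : G3Setup p)

/-- The clearing box of the half-point monomials: `2 L_j |s₁|`. [folklore] -/
def halfE (L : Fin S.n → ℕ) (s₁ : ℤ) : Fin S.n → ℕ := fun j => 2 * L j * s₁.natAbs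

/-- `⌊e_j/2⌋ ≤ 2 L_j |s₁|` for the natural root exponents `e = rootExp L w s₁` in the box. [folklore] -/
theorem rootExp_div_two_le {L : Fin S.n → ℕ} {w : Fin S.n → ℤ} (hw : ∀ j, |w j| ≤ (L j : ℤ)) (s₁ : ℤ) (j : Fin S.n) :
    S.rootExp L w s₁ j / 2 ≤ S.halfE L s₁ j := by
  have hc := S.rootExp_cast hw s₁ j
  have h1 : |w j * s₁| ≤ L j * |s₁| := by rw [abs_mul]; exact mul_le_mul_of_nonneg_right (hw j) (abs_nonneg _)
  have h2 : w j * s₁ ≤ L j * |s₁| := (abs_le.mp h1).2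
  have h3 : ((S.rootExp L w s₁ j : ℕ) : ℤ) ≤ 3 * (L j * |s₁|) := by rw [hc]; linarith
  unfold halfE
  have h4 : (S.rootExp L w s₁ j : ℤ) ≤ 3 * (L j * (s₁.natAbs : ℤ)) := by rw [Int.natCast_natAbs]; exact h3
  have h5 : S.rootExp L w s₁ j ≤ 3 * (L j * s₁.natAbs) := by exact_mod_cast h4
  rw [mul_assoc]
  omega

/-- **The rational part cleared**: `monDen(α, 2L|s₁|) · qEhG α (rootExp L w s₁) ∈ ℤ` with `|·| ≤ monDen²`. [cite: Nesterenko2003, §3.2; shape only] -/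
theorem exists_int_monDen_mul_qEhG {L : Fin S.n → ℕ} {w : Fin S.n → ℤ} (hw : ∀ j, |w j| ≤ (L j : ℤ)) (s₁ : ℤ) :
    ∃ z : ℤ, ((MonomialDen.monDen S.α (S.halfE L s₁) : ℕ) : ℚ) * HalfMono.qEhG S.α (S.rootExp L w s₁) = z ∧
      |z| ≤ ((MonomialDen.monDen S.α (S.halfE L s₁) : ℤ)) ^ 2 := by
  have h := MonomialDen.exists_int_monDen_mul_prod_zpow S.α S.α_ne (S.halfE L s₁) (fun j => ((S.rootExp L w s₁ j / 2 : ℕ) : ℤ))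
    (fun j => by rw [Nat.abs_cast]; exact_mod_cast S.rootExp_div_two_le hw s₁ j)
  unfold HalfMono.qEhG
  simp_rw [zpow_natCast] at h
  exact h

/-- `|b_{j₀}|^{|t|} · ∏_k zγ(w)_k^{t_k} = ±∏_k 𝔛(w)_k^{t_k}`. [folklore] -/
theorem natAbs_pow_mul_prod_zγ_pow (w : Fin S.n → ℤ) (t : Fin S.n → ℕ) :
    (((S.b S.j₀).natAbs ^ (∑ k, t k) : ℕ) : ℚ) * ∏ k, S.zγ w k ^ t k =
      ((S.b S.j₀).sign : ℚ) ^ (∑ k, t k) * ((∏ k, S.𝔛 w k ^ t k : ℤ) : ℚ) := by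
  have hz := S.bj₀_pow_mul_zγpow (fun _ : Unit => w) () t
  unfold zγpow at hz
  have hsgn : (((S.b S.j₀).natAbs : ℕ) : ℚ) = ((S.b S.j₀).sign : ℚ) * S.b S.j₀ := by
    rw [Nat.cast_natAbs]; push_cast
    rw [← Int.cast_abs, ← Int.sign_mul_self_eq_abs]; push_cast; ring
  push_cast
  rw [hsgn, mul_pow, mul_assoc, hz]

/-- **Integrality and size of the half-step class-sum terms** (the `hint`/`hsize` of `HalfStepHypU`, uniform in the box): for `lev < Ŝ`,
`H ≥ 1`, `|w_j| ≤ L_j`, `|𝔛(w)_k| ≤ Xb`, and `M₀′ ≥ 2^{(Ŝ−lev−1)t₀} ν(H)^{t₀} e^{H/e} (e(1 + 2^{Ŝ−lev−1}|s₁|/H))^{ℓ₀}`: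
`D · htermW ∈ ℤ` with `D = ν(H)^{t₀}|b_{j₀}|^{|t|} monDen(α, 2L|s₁|)`, and `|htermW| ≤ 2^{t₀} M₀′ Xb^{|t|} monDen(α, 2L|s₁|)`.
[cite: Yu2013, (5.35)–(5.39); shape only] -/
theorem htermW_clear {H Sh lev : ℕ} (hH : 1 ≤ H) (hlev : lev < Sh) (i : ℕ × (Fin S.n → ℤ)) {L : Fin S.n → ℕ}
    {w : Fin S.n → ℤ} (hw : ∀ j, |w j| ≤ (L j : ℤ)) (s₁ : ℤ) (τ : Tau S.n) {M₀' : ℤ}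
    (hM : (2 : ℝ) ^ ((Sh - (lev + 1)) * τ.1) * ((Nat.lcmUpto H : ℝ) ^ τ.1 *
      (Real.exp (H / Real.exp 1) * (Real.exp 1 * (1 + |((2 ^ (Sh - (lev + 1)) * s₁ : ℤ) : ℝ)| / H)) ^ i.1)) ≤ M₀')
    {Xb : ℤ} (hX : ∀ k, |S.𝔛 w k| ≤ Xb) :
    (∃ z : ℤ, (((Nat.lcmUpto H) ^ τ.1 * (S.b S.j₀).natAbs ^ (∑ k, τ.2 k) * MonomialDen.monDen S.α (S.halfE L s₁) : ℕ) : ℚ) *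
        S.htermW (S.Rl H Sh lev) L s₁ τ i w = z) ∧
    |(S.htermW (S.Rl H Sh lev) L s₁ τ i w : ℝ)| ≤
      (2 : ℝ) ^ τ.1 * M₀' * (Xb : ℝ) ^ (∑ k, τ.2 k) * (MonomialDen.monDen S.α (S.halfE L s₁) : ℝ) := by
  obtain ⟨z₀, hz₀, hz₀le⟩ := S.exists_int_lcm_pow_mul_hasse_Rl hH Sh (lev + 1) i τ.1 s₁ hM
  obtain ⟨z₂, hz₂, hz₂le⟩ := S.exists_int_monDen_mul_qEhG hw s₁
  set z₁ : ℤ := ∏ k, S.𝔛 w k ^ τ.2 k with hz₁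
  have hz₁le : |z₁| ≤ Xb ^ (∑ k, τ.2 k) := by
    rw [hz₁, Finset.abs_prod, ← Finset.prod_pow_eq_pow_sum]
    refine Finset.prod_le_prod (fun k _ => abs_nonneg _) fun k _ => ?_
    rw [abs_pow]; exact pow_le_pow_left₀ (abs_nonneg _) (hX k) _
  have hhalf := S.hasse_Rl_half (H := H) hlev i τ.1 s₁
  have hγ := S.natAbs_pow_mul_prod_zγ_pow w τ.2
  -- positivity of the clearing factors
  have hν : 1 ≤ Nat.lcmUpto H := Nat.lcmUpto_pos H
  have hb1 : 1 ≤ (S.b S.j₀).natAbs := Int.natAbs_pos.mpr S.bj₀_ne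
  have hmon1 : 1 ≤ MonomialDen.monDen S.α (S.halfE L s₁) := MonomialDen.one_le_monDen _ S.α_ne _
  have hsgn1 : |((S.b S.j₀).sign : ℚ) ^ (∑ k, τ.2 k)| = 1 := by
    rw [abs_pow]
    have : |((S.b S.j₀).sign : ℚ)| = 1 := by
      rcases lt_or_gt_of_ne S.bj₀_ne with h | h
      · rw [Int.sign_eq_neg_one_of_neg h]; norm_num
      · rw [Int.sign_eq_one_of_pos h]; norm_num
    rw [this, one_pow]
  constructor
  · refine ⟨2 ^ τ.1 * z₀ * ((S.b S.j₀).sign ^ (∑ k, τ.2 k) * z₁) * z₂, ?_⟩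
    unfold htermW
    rw [hhalf]
    push_cast
    have e2 := hγ
    push_cast at e2 hz₀ hz₂
    calc ((Nat.lcmUpto H : ℚ)) ^ τ.1 * (((S.b S.j₀).natAbs : ℕ) : ℚ) ^ (∑ k, τ.2 k) * (MonomialDen.monDen S.α (S.halfE L s₁) : ℚ) *
          (((2 : ℚ) ^ τ.1 * (hasseDeriv τ.1 (S.Rl H Sh (lev + 1) i)).eval (s₁ : ℚ) * (∏ k, S.zγ w k ^ τ.2 k)) *
            HalfMono.qEhG S.α (S.rootExp L w s₁))
        = (2 : ℚ) ^ τ.1 * (((Nat.lcmUpto H : ℚ)) ^ τ.1 * (hasseDeriv τ.1 (S.Rl H Sh (lev + 1) i)).eval (s₁ : ℚ)) *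
          ((((S.b S.j₀).natAbs : ℕ) : ℚ) ^ (∑ k, τ.2 k) * (∏ k, S.zγ w k ^ τ.2 k)) *
          ((MonomialDen.monDen S.α (S.halfE L s₁) : ℚ) * HalfMono.qEhG S.α (S.rootExp L w s₁)) := by ring
      _ = (2 : ℚ) ^ τ.1 * (z₀ : ℚ) * (((S.b S.j₀).sign : ℚ) ^ (∑ k, τ.2 k) * (z₁ : ℚ)) * (z₂ : ℚ) := by
          rw [hz₀, e2, hz₂, hz₁]; push_cast; ring
  · -- the size
    have hν0 : (0 : ℝ) < (Nat.lcmUpto H : ℝ) ^ τ.1 := by positivity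
    have hb0 : (0 : ℝ) < (((S.b S.j₀).natAbs : ℕ) : ℝ) ^ (∑ k, τ.2 k) := by
      have : (0 : ℝ) < (((S.b S.j₀).natAbs : ℕ) : ℝ) := by exact_mod_cast hb1
      positivity
    have hm0 : (0 : ℝ) < (MonomialDen.monDen S.α (S.halfE L s₁) : ℝ) := by exact_mod_cast hmon1
    -- the three factors
    have hA : |((((hasseDeriv τ.1 (S.Rl H Sh lev i)).eval ((s₁ : ℚ) / 2) : ℚ)) : ℝ)| ≤ (2 : ℝ) ^ τ.1 * M₀' := by
      rw [hhalf]
      have h1 : |(((hasseDeriv τ.1 (S.Rl H Sh (lev + 1) i)).eval (s₁ : ℚ) : ℚ) : ℝ)| ≤ M₀' := by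
        have hq : ((hasseDeriv τ.1 (S.Rl H Sh (lev + 1) i)).eval (s₁ : ℚ) : ℚ) = (z₀ : ℚ) / ((Nat.lcmUpto H) ^ τ.1 : ℕ) := by
          rw [eq_div_iff (by exact_mod_cast (pow_pos hν τ.1).ne'), mul_comm]; exact hz₀
        rw [hq]; push_cast
        rw [abs_div, abs_of_pos hν0, div_le_iff₀ hν0]
        have h0 : (0 : ℝ) ≤ M₀' := by exact_mod_cast (abs_nonneg _).trans hz₀le
        calc |(z₀ : ℝ)| ≤ M₀' := by exact_mod_cast hz₀le
          _ = M₀' * 1 := (mul_one _).symm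
          _ ≤ M₀' * (Nat.lcmUpto H : ℝ) ^ τ.1 := mul_le_mul_of_nonneg_left (one_le_pow₀ (by exact_mod_cast hν)) h0
      push_cast
      rw [abs_mul, abs_pow, abs_two]
      exact mul_le_mul_of_nonneg_left h1 (by positivity)
    have hB : |((∏ k, S.zγ w k ^ τ.2 k : ℚ) : ℝ)| ≤ (Xb : ℝ) ^ (∑ k, τ.2 k) := by
      have hq : (∏ k, S.zγ w k ^ τ.2 k : ℚ) = ((S.b S.j₀).sign : ℚ) ^ (∑ k, τ.2 k) * (z₁ : ℚ) / (((S.b S.j₀).natAbs ^ (∑ k, τ.2 k) : ℕ) : ℚ) := by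
        rw [eq_div_iff (by exact_mod_cast (pow_pos hb1 _).ne'), mul_comm]; exact hγ
      rw [hq]; push_cast
      rw [abs_div, abs_mul]
      have hs1 : |(((S.b S.j₀).sign : ℤ) : ℝ) ^ (∑ k, τ.2 k)| = 1 := by
        rw [abs_pow]
        have : |(((S.b S.j₀).sign : ℤ) : ℝ)| = 1 := by
          rcases lt_or_gt_of_ne S.bj₀_ne with h | h
          · rw [Int.sign_eq_neg_one_of_neg h]; norm_num
          · rw [Int.sign_eq_one_of_pos h]; norm_num
        rw [this, one_pow]
      rw [hs1, one_mul, abs_of_pos hb0, div_le_iff₀ hb0]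
      have hX0 : (0 : ℝ) ≤ (Xb : ℝ) ^ (∑ k, τ.2 k) := by exact_mod_cast (abs_nonneg _).trans hz₁le
      calc |(z₁ : ℝ)| ≤ (Xb : ℝ) ^ (∑ k, τ.2 k) := by exact_mod_cast hz₁le
        _ = (Xb : ℝ) ^ (∑ k, τ.2 k) * 1 := (mul_one _).symm
        _ ≤ (Xb : ℝ) ^ (∑ k, τ.2 k) * (((S.b S.j₀).natAbs : ℕ) : ℝ) ^ (∑ k, τ.2 k) :=
            mul_le_mul_of_nonneg_left (one_le_pow₀ (by exact_mod_cast hb1)) hX0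
    have hC : |(HalfMono.qEhG S.α (S.rootExp L w s₁) : ℝ)| ≤ (MonomialDen.monDen S.α (S.halfE L s₁) : ℝ) := by
      have hq : HalfMono.qEhG S.α (S.rootExp L w s₁) = (z₂ : ℚ) / ((MonomialDen.monDen S.α (S.halfE L s₁) : ℕ) : ℚ) := by
        rw [eq_div_iff (by exact_mod_cast (show (0:ℕ) < _ from hmon1).ne'), mul_comm]; exact hz₂
      rw [hq]; push_cast
      rw [abs_div, abs_of_pos hm0, div_le_iff₀ hm0]
      have : |(z₂ : ℝ)| ≤ (MonomialDen.monDen S.α (S.halfE L s₁) : ℝ) ^ 2 := by exact_mod_cast hz₂le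
      rw [pow_two] at this; exact this
    have hB' : |∏ k, ((S.zγ w k : ℚ) : ℝ) ^ τ.2 k| ≤ (Xb : ℝ) ^ (∑ k, τ.2 k) := by push_cast at hB; exact hB
    unfold htermW
    push_cast
    rw [abs_mul, abs_mul]
    have h2 : (0 : ℝ) ≤ (2 : ℝ) ^ τ.1 * M₀' := le_trans (abs_nonneg _) hA
    calc |((((hasseDeriv τ.1 (S.Rl H Sh lev i)).eval ((s₁ : ℚ) / 2) : ℚ)) : ℝ)| * |∏ k, ((S.zγ w k : ℚ) : ℝ) ^ τ.2 k| *
          |(HalfMono.qEhG S.α (S.rootExp L w s₁) : ℝ)|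
        ≤ ((2 : ℝ) ^ τ.1 * M₀') * (Xb : ℝ) ^ (∑ k, τ.2 k) * (MonomialDen.monDen S.α (S.halfE L s₁) : ℝ) := by
          refine mul_le_mul (mul_le_mul hA hB' (abs_nonneg _) h2) hC (abs_nonneg _) ?_
          exact mul_nonneg h2 ((abs_nonneg _).trans hB')
      _ = (2 : ℝ) ^ τ.1 * M₀' * (Xb : ℝ) ^ (∑ k, τ.2 k) * (MonomialDen.monDen S.α (S.halfE L s₁) : ℝ) := by ring

end G3Setup

end Summit.ABC.StewartYu

end
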